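import Summits.QuantumAdvantage.AdviceFreeQNC0.GenuineProductBound
import HarnessLib

/-!
# Cell qa-qnc0 (rung F-Q1, route RingFrame, crux α): walk-core basics — fail patterns as even
# triples, linearity and charge duality of the walk win pattern, the genuine rows
# (planner qa-qnc0-p1 ROUND-9 §2 / Sketch10 §22.2, ask P9 — the S-sized identities)

Statements VERBATIM from `Sketch10.lean` §22.2 (`IsWalkRow`, `IsEvenTriple`, `FailComplIffEvenTriple`,
`RingWinUXor`, `RingWinUCompl`, `stakes1`, `genuineRow`, `GenuineRowOnClass`, `GenuineRowColDeg`;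
`induced` is the topic's, `InducedStrategy.lean`, same body) and PROVED:

* E1 `failCompl_iff_evenTriple : FailComplIffEvenTriple` — complements of fail patterns of degree
  `≤ D` are exactly the patterns `w ↦ P_{|w| mod 3}(w)` of EVEN triples `P₀ ⊕ P₁ ⊕ P₂ = 0` of degree
  `≤ D` (class-`0` form: `(P₀, P₁, P₂) = (b, a ⊕ b, a)`);
* `ringWinU_xor : RingWinUXor` — the walk win pattern is `𝔽₂`-linear in the strategy (the live
  set `{g : c + g + e_g(u) ≢ 0}` does not depend on `y`);
* E5 `ringWinU_compl : RingWinUCompl` — CHARGE DUALITY: complementing the input maps charge `c` to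
  `c''` with `c + c'' + n ≡ 0 (mod 3)` (`e_g(ū) = n + g − e_g(u)`);
* W1' `genuineRowOnClass : GenuineRowOnClass`, W1'' `genuineRowColDeg : GenuineRowColDeg` — the
  genuine LDMA rows agree with member 1's success pattern on their label class and have column
  degree `≤ D` (`genuineRow c y = stakesRow (stakeA c y) (stakeB c y)` by `rfl`).

WHAT THIS IS NOT: E2 (loss identity), E3, E4, E6, W1 (genuine rows = WIN of the induced strategy),
W2/W3 and the hub are NOT in this file; nothing on α or the separation.
-/

noncomputable section

namespace Summit.QuantumAdvantage.AdviceFreeQNC0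

open Finset
open Literature.Computability.MetaComplexity Literature.Computability.MetaComplexity.Smolensky

/-! ### Vocabulary (verbatim from `Sketch10` §22.2) -/

/-- `z` is the WIN pattern of a walk strategy of degree `≤ D` at charge `c'` on `L'` bits. -/
def IsWalkRow {L' : ℕ} (c' D : ℕ) (z : (Fin L' → Bool) → Bool) : Prop :=
  ∃ y : Fin (L' + 1) → (Fin L' → Bool) → Bool, (∀ g, HasDeg (y g) D) ∧ ∀ v, z v = ringWinU c' y v

/-- an EVEN eliminator triple of degree `≤ D`. -/
def IsEvenTriple {ℓ : ℕ} (D : ℕ) (P : ℕ → (Fin ℓ → Bool) → Bool) : Prop :=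
  (∀ r, HasDeg (P r) D) ∧ ∀ w, xor (P 0 w) (xor (P 1 w) (P 2 w)) = false

/-- **E1**: complements of fail patterns = even-triple patterns. -/
def FailComplIffEvenTriple : Prop :=
  ∀ ℓ D : ℕ, ∀ F : (Fin ℓ → Bool) → Bool,
    IsElimFail D F ↔ ∃ P : ℕ → (Fin ℓ → Bool) → Bool, IsEvenTriple D P ∧ ∀ w, F w = !(P (wt w % 3) w)

/-- linearity of the walk win pattern in the strategy. -/
def RingWinUXor : Prop :=
  ∀ n c : ℕ, ∀ y y' : Fin (n + 1) → (Fin n → Bool) → Bool, ∀ u : Fin n → Bool,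
    ringWinU c (fun g w => xor (y g w) (y' g w)) u = xor (ringWinU c y u) (ringWinU c y' u)

/-- **E5 — CHARGE DUALITY**. -/
def RingWinUCompl : Prop :=
  ∀ n c c'' : ℕ, (c + c'' + n) % 3 = 0 → ∀ y : Fin (n + 1) → (Fin n → Bool) → Bool,
    ∀ u : Fin n → Bool,
      ringWinU c y (fun i => !(u i)) = ringWinU c'' (fun g w => y g (fun i => !(w i))) u

/-- member 1's column-`v` stakes re-staked to class `0`. -/
def stakes1 {L L' : ℕ} (c : ℕ) (y : Fin (L + L' + 1) → (Fin (L + L') → Bool) → Bool)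
    (u : Fin L → Bool) (v : Fin L' → Bool) : Bool × Bool :=
  rot0 (c + wt v) (xor (F1 y v u).1 (F1 y v u).2) (F1 y v u).2

/-- the genuine LDMA instance of label `r`: `Γ_r u v = triple r (stakes1 c y u v)`. -/
def genuineRow {L L' : ℕ} (c : ℕ) (y : Fin (L + L' + 1) → (Fin (L + L') → Bool) → Bool)
    (r : Fin 3) (u : Fin L → Bool) (v : Fin L' → Bool) : Bool :=
  triple r (stakes1 c y u v).1 (stakes1 c y u v).2

/-- W1': on the rows of label `r` the instance IS member 1's success pattern. -/
def GenuineRowOnClass : Prop :=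
  ∀ L L' c : ℕ, ∀ y : Fin (L + L' + 1) → (Fin (L + L') → Bool) → Bool, ∀ u : Fin L → Bool,
    ∀ v : Fin L' → Bool, genuineRow c y (resLabel u) u v = win1 c (F1 y) u v

/-- W1'': column degree of the genuine instance. -/
def GenuineRowColDeg : Prop :=
  ∀ L L' c D : ℕ, ∀ y : Fin (L + L' + 1) → (Fin (L + L') → Bool) → Bool,
    (∀ g, HasDeg (y g) D) → ∀ r : Fin 3, ∀ v : Fin L' → Bool,
      HasDeg (fun u : Fin L → Bool => genuineRow c y r u v) D

/-! ### E1: fail patterns and even triples -/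

/-- The class-`0` failure table read on residues: `¬ elimFailBits 0 α β w = (β, α ⊕ β, α)_{w mod 3}`. -/
private theorem not_elimFailBits_zero (α β : Bool) (w : ℕ) :
    (!elimFailBits 0 α β w) = (if w % 3 = 0 then β else if w % 3 = 1 then xor α β else α) := by
  have key : ∀ t : Fin 3, ∀ α β : Bool, (!elimFailBits 0 α β t.val) =
      (if t.val = 0 then β else if t.val = 1 then xor α β else α) := by decide
  rw [elimFailBits_mod, Nat.zero_mod]
  exact key ⟨w % 3, Nat.mod_lt _ (by norm_num)⟩ α β

/-- **E1 `FailComplIffEvenTriple`.** -/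
theorem failCompl_iff_evenTriple : FailComplIffEvenTriple := by
  intro ℓ D F
  constructor
  · -- a fail pattern, in class-`0` form `(a, b)`, is the complement of the even triple `(b, a ⊕ b, a)`
    intro hF
    obtain ⟨a, b, ha, hb, hFab⟩ := isElimFail_class0 hF
    refine ⟨fun t w => if t % 3 = 0 then b w else if t % 3 = 1 then xor (a w) (b w) else a w,
      ⟨fun t => ?_, fun w => ?_⟩, fun w => ?_⟩
    · show HasDeg (fun w => if t % 3 = 0 then b w else if t % 3 = 1 then xor (a w) (b w) else a w) D
      by_cases h0 : t % 3 = 0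
      · have e : (fun w => if t % 3 = 0 then b w else if t % 3 = 1 then xor (a w) (b w) else a w) = b := by
          funext w; rw [if_pos h0]
        rw [e]; exact hb
      · by_cases h1 : t % 3 = 1
        · have e : (fun w => if t % 3 = 0 then b w else if t % 3 = 1 then xor (a w) (b w) else a w) =
              fun w => xor (a w) (b w) := by
            funext w; rw [if_neg h0, if_pos h1]
          rw [e]; exact hasDeg_xor ha hb
        · have e : (fun w => if t % 3 = 0 then b w else if t % 3 = 1 then xor (a w) (b w) else a w) = a := by
            funext w; rw [if_neg h0, if_neg h1]
          rw [e]; exact ha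
    · simp only [Nat.zero_mod, if_true, Nat.one_mod, one_ne_zero, if_false,
        show (2 : ℕ) % 3 = 2 from rfl, show ((2 : ℕ) = 0) = False by simp, show ((2 : ℕ) = 1) = False by simp]
      cases a w <;> cases b w <;> rfl
    · rw [hFab w]
      unfold elimFail
      have h := not_elimFailBits_zero (a w) (b w) (wt w)
      simp only [Nat.mod_mod]
      rw [← h, Bool.not_not]
  · -- an even triple `P` is the complement of the class-`0` fail pattern of `(P₂, P₀)`
    rintro ⟨P, ⟨hPdeg, hPeven⟩, hFP⟩
    refine ⟨0, P 2, P 0, hPdeg 2, hPdeg 0, fun w => ?_⟩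
    rw [hFP w]
    unfold elimFail
    have h := not_elimFailBits_zero (P 2 w) (P 0 w) (wt w)
    have h1 : P 1 w = xor (P 2 w) (P 0 w) := by
      have := hPeven w
      revert this
      cases P 0 w <;> cases P 1 w <;> cases P 2 w <;> decide
    have hP : P (wt w % 3) w = (if wt w % 3 = 0 then P 0 w else if wt w % 3 = 1 then xor (P 2 w) (P 0 w)
        else P 2 w) := by
      have hmod : wt w % 3 = 0 ∨ wt w % 3 = 1 ∨ wt w % 3 = 2 := by omega
      rcases hmod with h2 | h2 | h2
      · rw [h2]; simp
      · rw [h2]; simp [h1]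
      · rw [h2]; simp
    rw [hP, ← h, Bool.not_not]

/-! ### Linearity and charge duality of the walk win pattern -/

/-- Parity of a filter as a sum in `𝔽₂`. -/
private theorem decide_card_mod_two {ι : Type*} (s : Finset ι) (p : ι → Prop) [DecidablePred p] :
    decide ((s.filter p).card % 2 = 1) = decide ((∑ i ∈ s, if p i then (1 : ZMod 2) else 0) = 1) := by
  rw [Finset.sum_boole]
  apply decide_eq_decide.2
  rw [ZMod.natCast_eq_one_iff_odd, Nat.odd_iff]

/-- **`RingWinUXor`**: the win pattern is linear in the strategy. -/
theorem ringWinU_xor : RingWinUXor := by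
  intro n c y y' u
  unfold ringWinU
  rw [decide_card_mod_two, decide_card_mod_two, decide_card_mod_two]
  have e : (∑ g : Fin (n + 1), if (xor (y g u) (y' g u) = true ∧ (c + g.val + walkExp u g.val) % 3 ≠ 0)
      then (1 : ZMod 2) else 0) =
      (∑ g : Fin (n + 1), if (y g u = true ∧ (c + g.val + walkExp u g.val) % 3 ≠ 0) then (1 : ZMod 2) else 0) +
      (∑ g : Fin (n + 1), if (y' g u = true ∧ (c + g.val + walkExp u g.val) % 3 ≠ 0) then (1 : ZMod 2) else 0) := by
    rw [← Finset.sum_add_distrib]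
    refine Finset.sum_congr rfl fun g _ => ?_
    by_cases hl : (c + g.val + walkExp u g.val) % 3 ≠ 0
    · have h11 : (1 : ZMod 2) + 1 = 0 := by decide
      cases y g u <;> cases y' g u <;> simp [hl, h11]
    · simp [hl]
  rw [e]
  generalize (∑ g : Fin (n + 1), if (y g u = true ∧ (c + g.val + walkExp u g.val) % 3 ≠ 0)
    then (1 : ZMod 2) else 0) = a
  generalize (∑ g : Fin (n + 1), if (y' g u = true ∧ (c + g.val + walkExp u g.val) % 3 ≠ 0)
    then (1 : ZMod 2) else 0) = b
  revert a b; decide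

/-- Weight of the complement. -/
theorem wt_not {n : ℕ} (u : Fin n → Bool) : wt (fun i => !u i) = n - wt u := by
  unfold wt
  have h := Finset.card_filter_add_card_filter_not (s := (univ : Finset (Fin n))) (fun i => u i = true)
  rw [Finset.card_univ, Fintype.card_fin] at h
  have e : (univ.filter fun i : Fin n => (!u i) = true) = univ.filter fun i => ¬ u i = true :=
    Finset.filter_congr fun i _ => by simp
  rw [e]; omega

/-- Prefix weight of the complement: `W_g(ū) = g − W_g(u)` for `g ≤ n`. -/
theorem wtPrefix_not {n : ℕ} (u : Fin n → Bool) {g : ℕ} (hg : g ≤ n) :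
    wtPrefix (fun i => !u i) g = g - wtPrefix u g := by
  unfold wtPrefix
  have hlt : ((univ : Finset (Fin n)).filter fun i : Fin n => i.val < g).card = g := by
    have h : ((univ : Finset (Fin n)).filter fun i : Fin n => i.val < g).card = (Finset.range g).card :=
      Finset.card_bij (fun i _ => i.val) (fun i hi => Finset.mem_range.2 (Finset.mem_filter.1 hi).2)
        (fun i _ j _ h => Fin.ext h) (fun k hk => ⟨⟨k, lt_of_lt_of_le (Finset.mem_range.1 hk) hg⟩,
          Finset.mem_filter.2 ⟨Finset.mem_univ _, Finset.mem_range.1 hk⟩, rfl⟩)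
    rw [Finset.card_range] at h
    exact h
  have h := Finset.card_filter_add_card_filter_not
    (s := (univ : Finset (Fin n)).filter fun i : Fin n => i.val < g) (fun i => u i = true)
  rw [Finset.filter_filter, Finset.filter_filter, hlt] at h
  have e : (univ.filter fun i : Fin n => i.val < g ∧ (!u i) = true) =
      univ.filter fun i : Fin n => i.val < g ∧ ¬ u i = true := Finset.filter_congr fun i _ => by simp
  rw [e]; omega

/-- **E5 `RingWinUCompl` — charge duality.** -/
theorem ringWinU_compl : RingWinUCompl := by
  intro n c c'' hcc y u
  have key : ∀ g : Fin (n + 1), ((c + g.val + walkExp (fun i => !u i) g.val) % 3 ≠ 0 ↔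
      (c'' + g.val + walkExp u g.val) % 3 ≠ 0) := by
    intro g
    unfold walkExp
    rw [wt_not, wtPrefix_not u (Nat.lt_succ_iff.1 g.isLt)]
    have h1 : wt u ≤ n := by
      unfold wt; exact (Finset.card_le_univ _).trans_eq (Fintype.card_fin n)
    have h2 : wtPrefix u g.val ≤ g.val := by
      unfold wtPrefix
      calc (univ.filter fun i : Fin n => i.val < g.val ∧ u i = true).card
          ≤ (univ.filter fun i : Fin n => i.val < g.val).card :=
            Finset.card_le_card (Finset.monotone_filter_right _ fun i _ h => h.1)
        _ ≤ (Finset.range g.val).card := by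
            refine Finset.card_le_card_of_injOn (fun i => i.val) (fun i hi => ?_) ?_
            · rw [Finset.mem_coe, Finset.mem_filter] at hi
              exact Finset.mem_coe.2 (Finset.mem_range.2 hi.2)
            · intro i _ j _ h; exact Fin.ext h
        _ = g.val := Finset.card_range _
    omega
  have hS : ((univ : Finset (Fin (n + 1))).filter fun g : Fin (n + 1) =>
      y g (fun i => !u i) = true ∧ (c + g.val + walkExp (fun i => !u i) g.val) % 3 ≠ 0) =
      (univ : Finset (Fin (n + 1))).filter fun g : Fin (n + 1) =>
        (fun g w => y g (fun i => !w i)) g u = true ∧ (c'' + g.val + walkExp u g.val) % 3 ≠ 0 :=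
    Finset.filter_congr fun g _ => by rw [key g]
  unfold ringWinU
  rw [hS]

/-! ### The genuine rows -/

/-- `genuineRow` is the `stakesRow` of the explicit class-`0` stakes (`GenuineProductBound.lean`). -/
theorem genuineRow_eq_stakesRow {L L' : ℕ} (c : ℕ) (y : Fin (L + L' + 1) → (Fin (L + L') → Bool) → Bool)
    (r : Fin 3) (u : Fin L → Bool) (v : Fin L' → Bool) :
    genuineRow c y r u v = stakesRow (stakeA c y) (stakeB c y) r u v := rfl

/-- **W1' `GenuineRowOnClass`.** -/
theorem genuineRowOnClass : GenuineRowOnClass := by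
  intro L L' c y u v
  rw [genuineRow_eq_stakesRow, win1_eq_stakes]
  unfold stakesRow elimFail
  rw [win_eq_triple]

/-- **W1'' `GenuineRowColDeg`.** -/
theorem genuineRowColDeg : GenuineRowColDeg := by
  intro L L' c D y hy r v
  have hA := hasDeg_stakeA c y hy v
  have hB := hasDeg_stakeB c y hy v
  have e : (fun u : Fin L → Bool => genuineRow c y r u v) = fun u => triple r (stakeA c y v u) (stakeB c y v u) := rfl
  rw [e]
  by_cases h0 : r.val = 0
  · have e' : (fun u => triple r (stakeA c y v u) (stakeB c y v u)) = stakeB c y v := by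
      funext u; unfold triple; rw [if_pos h0]
    rw [e']; exact hB
  · by_cases h1 : r.val = 1
    · have e' : (fun u => triple r (stakeA c y v u) (stakeB c y v u)) = stakeA c y v := by
        funext u; unfold triple; rw [if_neg h0, if_pos h1]
      rw [e']; exact hA
    · have e' : (fun u => triple r (stakeA c y v u) (stakeB c y v u)) =
          fun u => xor (stakeA c y v u) (stakeB c y v u) := by
        funext u; unfold triple; rw [if_neg h0, if_neg h1]
      rw [e']; exact hasDeg_xor hA hB

end Summit.QuantumAdvantage.AdviceFreeQNC0

end
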